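/-
Copyright (c) 2026 the pub-hodgecm-mathlib formalisation cell (harness21).  Prover seat hodgecm-mathlib-K2E5-p17 (g5), Track B «K2-LIT» ∕ h413
(`stmt-HodgeConjecture-24833`), line `K2_E3_EllipticInputs`, road «GL₂-sc» (road owner K2E5-p17 (g5); dealer D66), brick (2F-v): THE FRAME BRIDGE — a compatible
`ℤᵐ⁰`-valued valuation defining the topology of a non-archimedean local field given in the `ValuativeRel` frame.  2026-09-04.
-/
import Mathlib.NumberTheory.LocalField.Basic
import HarnessLib

/-!
# Road «GL₂-sc», brick (2F-v): from the `ValuativeRel` frame to the `Valued F ℤᵐ⁰` frame — a compatible rank-one integral valuation with the same topology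

Cell `pub/hodgecm-mathlib` (D-0151), Track B, seat K2E5-p17 (g5) (road owner «GL₂-sc» = Harish-Chandra's local integrability for supercuspidal `GL₂(F)`; BRICK LIST v1.1
`K2/K2E5-p17/g5/BRICKLIST-GL2sc-v1.1.K2E5-p17-g5.md` §2).  `--supports stmt-HodgeConjecture-24833 --as helper`; THEOREMS ONLY (no definition ∕ instance ∕ notation ∕
named fact ∕ `sorry`); never imports `Cruxes/…/Lines`.  COUNT-NEUTRAL, generic (any non-archimedean local field).

WHY.  The hosted socket (S-C′-GL₂sc) `sig_K2E3GL2SupercuspidalCharLocInt` (U12 ED. 24 :520) speaks the `ValuativeRel` frame `[Field F] [ValuativeRel F] [TopologicalSpace F]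
[IsNonarchimedeanLocalField F]` of its consumer (the (nsc-S-C′) tie), while the whole truncated-character chain of road «GL₂-sc» (twins of ★ road «GL-[M6]-sc») is written in
the `[Valued F ℤᵐ⁰] [ValuativeRel F] [Valued.v.Compatible]` frame with a uniformiser `v ϖ = exp(−1)`.  The final assembly (2A-2) bridges the two INSIDE ITS PROOF by
`letI : Valued F ℤᵐ⁰ := { ‹UniformSpace F›, ‹IsUniformAddGroup F› with v := v, is_topological_valuation := hv }` — for which it needs, as PROPOSITIONAL data, a valuation
`v : Valuation F ℤᵐ⁰` that is compatible with the valuative relation, defines the given topology at `0`, and takes the value `exp(−1)`.  This file supplies exactly that: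

**`exists_valuation_int_compatible`**: `∃ v : Valuation F ℤᵐ⁰, v.Compatible ∧ (∀ s, s ∈ 𝓝 0 ↔ ∃ γ : ℤᵐ⁰ˣ, {x | v x < γ} ⊆ s) ∧ ∃ ϖ, v ϖ = exp(−1)`
(transport the canonical valuation `valuation F : F → ValueGroupWithZero F` along Mathlib's order isomorphism `IsNonarchimedeanLocalField.valueGroupWithZeroIsoInt F :
ValueGroupWithZero F ≃*o ℤᵐ⁰`; `IsValuativeTopology.mem_nhds_zero_iff` for the topology; `valuation_surjective` for the uniformiser).
[Serre1979, Ch. II §1 (discrete valuations of a local field)]; [CasselsFrohlich1967, Ch. II §7 (normalised discrete valuation)].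
HONEST LABEL: HC_CM is proved only modulo the 7 printed citations (2 remaining named inputs: hLiu418 = stmt-HodgeConjecture-24832, h413 =
stmt-HodgeConjecture-24833) until rung 0 closes; count-neutral helper.
-/

set_option autoImplicit false
set_option linter.dupNamespace false   -- `Summit.HodgeConjecture.HodgeConjecture.…` (D-0017 nested layout; lakefile exemption for Summits)

noncomputable section

open ValuativeRel Topology Filter Set
open scoped WithZero

namespace Summit.HodgeConjecture.HodgeConjecture.Cruxes.H413.K2E3LocalFieldValuedOfValuativeRel

/-- **THE FRAME BRIDGE.**  For a non-archimedean local field `F` in the `ValuativeRel` frame there is a `ℤᵐ⁰`-valued valuation `v` on `F` which is COMPATIBLE with the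
valuative relation (`x ≤ᵥ y ↔ v x ≤ v y`), DEFINES THE TOPOLOGY at `0` (`s ∈ 𝓝 0 ↔ ∃ γ, {v < γ} ⊆ s` — Mathlib's `Valued.is_topological_valuation` field, so that
`{‹UniformSpace F› with v := v, …} : Valued F ℤᵐ⁰` reuses the given uniformity), and is NORMALISED (`v ϖ = exp(−1)` for some `ϖ`).  It is `e ∘ valuation F` for Mathlib's
order isomorphism `e = valueGroupWithZeroIsoInt F : ValueGroupWithZero F ≃*o ℤᵐ⁰`. [cite: Serre1979, Ch. II §1] [cite: CasselsFrohlich1967, Ch. II §7] -/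
theorem exists_valuation_int_compatible (F : Type*) [Field F] [ValuativeRel F] [TopologicalSpace F] [IsNonarchimedeanLocalField F] :
    ∃ v : Valuation F ℤᵐ⁰, v.Compatible ∧ (∀ s : Set F, s ∈ 𝓝 (0 : F) ↔ ∃ γ : ℤᵐ⁰ˣ, {x : F | v x < (γ : ℤᵐ⁰)} ⊆ s) ∧
      ∃ ϖ : F, v ϖ = WithZero.exp (-1 : ℤ) := by
  set e : ValueGroupWithZero F ≃*o ℤᵐ⁰ := IsNonarchimedeanLocalField.valueGroupWithZeroIsoInt F with he
  have hle : ∀ a b : ValueGroupWithZero F, e a ≤ e b ↔ a ≤ b := fun a b => map_le_map_iff e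
  have hlt : ∀ a b : ValueGroupWithZero F, e a < e b ↔ a < b := fun a b => map_lt_map_iff e
  -- the transported valuation
  let v : Valuation F ℤᵐ⁰ :=
    { toFun := fun x => e (valuation F x)
      map_zero' := by rw [map_zero, map_zero]
      map_one' := by rw [map_one, map_one]
      map_mul' := fun x y => by rw [map_mul, map_mul]
      map_add_le_max' := fun x y => by
        rcases le_max_iff.1 ((valuation F).map_add x y) with h | h
        · exact le_max_of_le_left ((hle _ _).2 h)
        · exact le_max_of_le_right ((hle _ _).2 h) }
  have hv : ∀ x, v x = e (valuation F x) := fun _ => rfl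
  refine ⟨v, ⟨fun x y => ?_⟩, fun s => ?_, ?_⟩
  · -- compatibility
    rw [hv, hv, hle]
    exact Valuation.Compatible.vle_iff_le x y
  · -- the topology at `0`
    rw [IsValuativeTopology.mem_nhds_zero_iff]
    constructor
    · rintro ⟨γ, hγ⟩
      have hγ0 : e (γ : ValueGroupWithZero F) ≠ 0 := by
        have h := (hlt 0 _).2 (zero_lt_iff.2 γ.ne_zero)
        rw [map_zero] at h
        exact h.ne'
      refine ⟨Units.mk0 _ hγ0, fun x hx => hγ ?_⟩
      simp only [mem_setOf_eq, Units.val_mk0, hv] at hx ⊢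
      exact (hlt _ _).1 hx
    · rintro ⟨γ, hγ⟩
      have hγ0 : e.symm (γ : ℤᵐ⁰) ≠ 0 := by
        have h := (hlt 0 (e.symm (γ : ℤᵐ⁰))).1 (by
          rw [map_zero, OrderMonoidIso.apply_symm_apply]; exact zero_lt_iff.2 γ.ne_zero)
        exact h.ne'
      refine ⟨Units.mk0 _ hγ0, fun x hx => hγ ?_⟩
      simp only [mem_setOf_eq, Units.val_mk0, hv] at hx ⊢
      have := (hlt _ _).2 hx
      rwa [OrderMonoidIso.apply_symm_apply] at this
  · -- a uniformiser
    obtain ⟨ϖ, hϖ⟩ := ValuativeRel.valuation_surjective (e.symm (WithZero.exp (-1 : ℤ)))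
    exact ⟨ϖ, by rw [hv, hϖ, OrderMonoidIso.apply_symm_apply]⟩

end Summit.HodgeConjecture.HodgeConjecture.Cruxes.H413.K2E3LocalFieldValuedOfValuativeRel

end
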